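import Summits.ValiantsHypothesis.ValiantsHypothesis.Theses.FeketeSOS
import Literature.NumberTheory.LFunctions.FeketePolynomial
import Literature.RingTheory.Valuation.AlgClosedResidue
import Literature.RingTheory.Valuation.RootReduction

/-!
# `FeketeSOS.FeketeNoSparseSplit` (stmt-ValiantsHypothesis-3997) — line `cyclic-valuation-dichotomy`

Lead's working skeleton (prover-line-stmt-ValiantsHypothesis-3997-0, 2026-08-16), reshaped from the planner's
`Cruxes/FeketeNoSparseSplit/Lines/cyclic-valuation-dichotomy.lean`:

* vocabulary: the planner's local `def fekete R p` is replaced by the tree's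
  `(Literature.NumberTheory.LFunctions.feketePolynomial p).map (Int.castRingHom R)` (no new definition; over `ℂ`
  this is LITERALLY the crux's inlined sum by `map_feketePolynomial_complex`), and the planner's
  `def FeketeNoSparseCyclicSplit : Prop` (`C⁺`) is stated directly as the theorem `feketeNoSparseCyclicSplit`;
* `stub_feketeModPOrder` is weakened to the inequality `(p-1)/2 ≤ ord₁ F̄_p` — the only direction the
  composition uses (the exact order `= (p-1)/2`, Mináč–Nguyen–Tân Prop 5.1, is true but not needed).

THE LINE: reduce a complex cyclic splitting `A·B ≡ F_p (mod X^p - 1)` at a place of `ℂ` above `p`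
(`stub_primitiveReduction`); in characteristic `p`, `X^p - 1 = (X-1)^p`, so orders at `1` add up
(`stub_cyclicOrderDichotomy`); Euler's criterion puts `F̄_p` at order `≥ (p-1)/2` at `1`
(`stub_feketeModPOrder`); a non-zero polynomial of degree `< p` divisible by `(X-1)^m` has `≥ m+1` monomials
(`stub_charPFewnomial`).  Hence `|supp A| + |supp B| ≥ (p+3)/2` (`feketeNoSparseCyclicSplit`, `C⁺`), and the
crux follows with `δ = 1/4`, `p₀ = 16` (`FeketeNoSparseSplit_of`).
-/

namespace Summit.ValiantsHypothesis.ValiantsHypothesis.Theorems.FeketeNoSparseSplitCyclic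

open Polynomial
open Literature.NumberTheory.LFunctions
open Summit.ValiantsHypothesis.ValiantsHypothesis.Theses

set_option linter.unusedVariables false
-- `Summit.ValiantsHypothesis.ValiantsHypothesis.…` is the tree's mandated single-conjunct layout (Sub = Summit).
set_option linter.dupNamespace false

/-! ## The four registered stubs -/

/-- **Stub 1 — char-`p` fewnomial bound.**  Over a field `K` of characteristic `p`, a non-zero polynomial `g`
of degree `< p` divisible by `(X - 1)^m` has at least `m + 1` monomials. -/
theorem stub_charPFewnomial :
    ∀ (K : Type) [Field K] (p : ℕ) [Fact p.Prime] [CharP K p] (g : K[X]) (m : ℕ),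
      g ≠ 0 → g.natDegree < p → (X - C (1 : K)) ^ m ∣ g → m + 1 ≤ g.support.card := by
  sorry

/-- **Stub 2 — the order of `F̄_p` at `1` is at least `(p-1)/2`** (Euler's criterion; in fact equality holds,
Mináč–Nguyen–Tân arXiv:2111.05256 Prop 5.1, not needed). -/
theorem stub_feketeModPOrder :
    ∀ (K : Type) [Field K] (p : ℕ) [Fact p.Prime] [CharP K p], p ≠ 2 →
      (p - 1) / 2 ≤ rootMultiplicity (1 : K) ((feketePolynomial p).map (Int.castRingHom K)) := by
  sorry

/-- **Stub 3 — the cyclic order dichotomy.**  Over a field `K` of characteristic `p`: if `A, B, F ≠ 0`,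
`deg F < p` and `X^p - 1 ∣ A·B - c·F`, then `ord₁ A + ord₁ B = ord₁ F` when `c ≠ 0`, and `ord₁ A + ord₁ B ≥ p`
when `c = 0`. -/
theorem stub_cyclicOrderDichotomy :
    ∀ (K : Type) [Field K] (p : ℕ) [Fact p.Prime] [CharP K p] (A B F : K[X]) (c : K),
      A ≠ 0 → B ≠ 0 → F ≠ 0 → F.natDegree < p →
      (X ^ p - 1 : K[X]) ∣ A * B - C c * F →
        (c ≠ 0 → rootMultiplicity (1 : K) A + rootMultiplicity (1 : K) B = rootMultiplicity (1 : K) F) ∧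
        (c = 0 → p ≤ rootMultiplicity (1 : K) A + rootMultiplicity (1 : K) B) := by
  sorry

/-- **Stub 4 — primitive reduction at a place of `ℂ` above `p` (the vehicle).**  A complex cyclic splitting
of `F_p` by non-zero `A, B` reduces, at a place of `ℂ` above `p` and after a primitive model of each factor,
to `X^p - 1 ∣ Ā·B̄ - c·F̄_p` over a field `K` of characteristic `p`, with `Ā, B̄ ≠ 0` supported inside
`supp A`, `supp B`. -/
theorem stub_primitiveReduction :
    ∀ (p : ℕ) [Fact p.Prime] (A B : ℂ[X]), A ≠ 0 → B ≠ 0 →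
      (X ^ p - 1 : ℂ[X]) ∣ A * B - (feketePolynomial p).map (Int.castRingHom ℂ) →
      ∃ (K : Type) (_ : Field K) (_ : CharP K p) (A' B' : K[X]) (c : K),
        A' ≠ 0 ∧ B' ≠ 0 ∧ A'.support ⊆ A.support ∧ B'.support ⊆ B.support ∧
        (X ^ p - 1 : K[X]) ∣ A' * B' - C c * (feketePolynomial p).map (Int.castRingHom K) := by
  sorry

/-! ## Proved facts about the reductions of `F_p` -/

/-- The coefficient of `X¹` in any reduction of `F_p` is `(1|p) = 1`. -/
theorem coeff_one_map_feketePolynomial (R : Type*) [CommRing R] (p : ℕ) [Fact p.Prime] :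
    ((feketePolynomial p).map (Int.castRingHom R)).coeff 1 = 1 := by
  rw [coeff_map, coeff_feketePolynomial_of_lt p (Fact.out : p.Prime).one_lt, Nat.cast_one,
    legendreSym.at_one, map_one]

/-- Every reduction of `F_p` to a non-trivial ring is non-zero. -/
theorem map_feketePolynomial_ne_zero (R : Type*) [CommRing R] [Nontrivial R] (p : ℕ) [Fact p.Prime] :
    (feketePolynomial p).map (Int.castRingHom R) ≠ 0 := by
  intro h
  have h1 := coeff_one_map_feketePolynomial R p
  rw [h, coeff_zero] at h1
  exact zero_ne_one h1

/-- `deg F̄_p < p`. -/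
theorem natDegree_map_feketePolynomial_lt (R : Type*) [CommRing R] (p : ℕ) [Fact p.Prime] :
    ((feketePolynomial p).map (Int.castRingHom R)).natDegree < p := by
  have hp : 0 < p := (Fact.out : p.Prime).pos
  refine lt_of_le_of_lt (natDegree_map_le) ?_
  rw [natDegree_feketePolynomial]
  omega

/-- `deg (X^p - 1) = p`. -/
theorem natDegree_X_pow_sub_one_eq (R : Type*) [CommRing R] [Nontrivial R] (n : ℕ) :
    ((X : R[X]) ^ n - 1).natDegree = n := by
  rw [← C_1, natDegree_X_pow_sub_C]

/-! ## The composition -/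

/-- **`C⁺` — no sparse CYCLIC splitting of the Fekete polynomial.**  For every odd prime `p` and all
`A, B ∈ ℂ[X]` of degree `< p` with `X^p - 1 ∣ A·B - F_p`:  `(p+3)/2 ≤ |supp A| + |supp B|`. -/
theorem feketeNoSparseCyclicSplit (p : ℕ) [Fact p.Prime] (hp2 : p ≠ 2) (A B : ℂ[X])
    (hA : A.natDegree < p) (hB : B.natDegree < p)
    (hdiv : (X ^ p - 1 : ℂ[X]) ∣ A * B - (feketePolynomial p).map (Int.castRingHom ℂ)) :
    (p + 3) / 2 ≤ A.support.card + B.support.card := by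
  classical
  have hprime : p.Prime := Fact.out
  have hF0 : (feketePolynomial p).map (Int.castRingHom ℂ) ≠ 0 := map_feketePolynomial_ne_zero ℂ p
  have hFdeg : ((feketePolynomial p).map (Int.castRingHom ℂ)).natDegree < p :=
    natDegree_map_feketePolynomial_lt ℂ p
  have hXp : ((X : ℂ[X]) ^ p - 1).natDegree = p := natDegree_X_pow_sub_one_eq ℂ p
  -- the factors are non-zero
  have hA0 : A ≠ 0 := by
    rintro rfl
    rw [zero_mul, zero_sub, dvd_neg] at hdiv
    have := natDegree_le_of_dvd hdiv hF0
    omega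
  have hB0 : B ≠ 0 := by
    rintro rfl
    rw [mul_zero, zero_sub, dvd_neg] at hdiv
    have := natDegree_le_of_dvd hdiv hF0
    omega
  -- reduce at a place of ℂ above p (stub 4)
  obtain ⟨K, instK, instC, A', B', c, hA', hB', hsA, hsB, hdiv'⟩ :=
    stub_primitiveReduction p A B hA0 hB0 hdiv
  have hF0' : (feketePolynomial p).map (Int.castRingHom K) ≠ 0 := map_feketePolynomial_ne_zero K p
  have hFdeg' : ((feketePolynomial p).map (Int.castRingHom K)).natDegree < p :=
    natDegree_map_feketePolynomial_lt K p
  -- orders at 1 (stubs 2 and 3)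
  have hord : (p - 1) / 2 ≤ rootMultiplicity (1 : K) ((feketePolynomial p).map (Int.castRingHom K)) :=
    stub_feketeModPOrder K p hp2
  have hdich := stub_cyclicOrderDichotomy K p A' B' _ c hA' hB' hF0' hFdeg' hdiv'
  have hsum : (p - 1) / 2 ≤ rootMultiplicity (1 : K) A' + rootMultiplicity (1 : K) B' := by
    by_cases hc : c = 0
    · have h := hdich.2 hc
      omega
    · have h := hdich.1 hc
      omega
  -- the reductions have degree < p
  have hdegA' : A'.natDegree < p :=
    lt_of_le_of_lt (le_natDegree_of_mem_supp _ (hsA (natDegree_mem_support_of_nonzero hA'))) hA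
  have hdegB' : B'.natDegree < p :=
    lt_of_le_of_lt (le_natDegree_of_mem_supp _ (hsB (natDegree_mem_support_of_nonzero hB'))) hB
  -- sparsity versus multiplicity (stub 1)
  have hcA : rootMultiplicity (1 : K) A' + 1 ≤ A'.support.card :=
    stub_charPFewnomial K p A' _ hA' hdegA' (pow_rootMultiplicity_dvd A' 1)
  have hcB : rootMultiplicity (1 : K) B' + 1 ≤ B'.support.card :=
    stub_charPFewnomial K p B' _ hB' hdegB' (pow_rootMultiplicity_dvd B' 1)
  have hcardA : A'.support.card ≤ A.support.card := Finset.card_le_card hsA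
  have hcardB : B'.support.card ≤ B.support.card := Finset.card_le_card hsB
  have hodd : p % 2 = 1 := Nat.odd_iff.mp (hprime.odd_of_ne_two hp2)
  omega

/-- **The crux from `C⁺`** (`δ = 1/4`, `p₀ = 16`): a polynomial splitting `A·B = F_p` has
`deg A, deg B ≤ deg F_p < p` and `X^p - 1 ∣ A·B - F_p = 0`, so `C⁺` gives `(p+3)/2 ≤ |supp A| + |supp B|`;
and `p^{3/4} ≤ p/2 ≤ (p+3)/2` because `p^{1/4} ≥ 2` for `p ≥ 16`. -/
theorem FeketeNoSparseSplit_of : FeketeSOS.FeketeNoSparseSplit := by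
  refine ⟨1 / 4, by norm_num, 16, ?_⟩
  intro p _ hp A B hAB
  have hprime : p.Prime := Fact.out
  have hp2 : p ≠ 2 := by omega
  have hAB' : A * B = (feketePolynomial p).map (Int.castRingHom ℂ) := by
    rw [map_feketePolynomial_complex]; exact hAB
  have hF0 : (feketePolynomial p).map (Int.castRingHom ℂ) ≠ 0 := map_feketePolynomial_ne_zero ℂ p
  have hFdeg : ((feketePolynomial p).map (Int.castRingHom ℂ)).natDegree < p :=
    natDegree_map_feketePolynomial_lt ℂ p
  have hA : A.natDegree < p :=
    lt_of_le_of_lt (natDegree_le_of_dvd (Dvd.intro _ hAB') hF0) hFdeg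
  have hB : B.natDegree < p :=
    lt_of_le_of_lt (natDegree_le_of_dvd (Dvd.intro_left _ hAB') hF0) hFdeg
  have hdiv : (X ^ p - 1 : ℂ[X]) ∣ A * B - (feketePolynomial p).map (Int.castRingHom ℂ) := by
    rw [hAB', sub_self]
    exact dvd_zero _
  have hnat : (p + 3) / 2 ≤ A.support.card + B.support.card :=
    feketeNoSparseCyclicSplit p hp2 A B hA hB hdiv
  -- real arithmetic: p^(3/4) ≤ p/2 ≤ (p+3)/2 ≤ |supp A| + |supp B|
  have hexp : (1 / 2 + 1 / 4 : ℝ) = 3 / 4 := by norm_num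
  rw [hexp]
  have hp16 : (16 : ℝ) ≤ p := by exact_mod_cast hp
  have hppos : (0 : ℝ) < p := by linarith
  have hcast : (((p + 3) / 2 : ℕ) : ℝ) ≤ (A.support.card : ℝ) + (B.support.card : ℝ) := by
    exact_mod_cast hnat
  have hhalf : (p : ℝ) / 2 ≤ (((p + 3) / 2 : ℕ) : ℝ) := by
    have h2 : p ≤ 2 * ((p + 3) / 2) := by omega
    have h2' : (p : ℝ) ≤ 2 * (((p + 3) / 2 : ℕ) : ℝ) := by exact_mod_cast h2
    linarith
  have hroot : (2 : ℝ) ≤ (p : ℝ) ^ (1 / 4 : ℝ) := by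
    have h16 : (16 : ℝ) ^ (1 / 4 : ℝ) = 2 := by
      rw [show (16 : ℝ) = 2 ^ (4 : ℝ) by norm_num, ← Real.rpow_mul (by norm_num)]
      norm_num
    rw [← h16]
    exact Real.rpow_le_rpow (by norm_num) hp16 (by norm_num)
  have hsplit : (p : ℝ) ^ (3 / 4 : ℝ) * (p : ℝ) ^ (1 / 4 : ℝ) = p := by
    rw [← Real.rpow_add hppos]
    norm_num
  have hnn : 0 ≤ (p : ℝ) ^ (3 / 4 : ℝ) := Real.rpow_nonneg hppos.le _
  have hpow : (p : ℝ) ^ (3 / 4 : ℝ) ≤ (p : ℝ) / 2 := by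
    have h := mul_le_mul_of_nonneg_left hroot hnn
    linarith
  linarith

/-- The crux, by its conventional closing name. -/
theorem FeketeNoSparseSplit_proof : FeketeSOS.FeketeNoSparseSplit := FeketeNoSparseSplit_of

end Summit.ValiantsHypothesis.ValiantsHypothesis.Theorems.FeketeNoSparseSplitCyclic
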